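import Summits.CriticalPhenomena.Ising3D.IsingColumnBracketL11
import HarnessLib

/-!
# F-CP1: (1a) ⇒ (1a-c)(U) — a full strip certificate set already contains the σ-column's upper face down to `∂B₁₁`
(cell `crit-ising-boot`, seat typing-1 gen 2; sibling of `IsingColumnBracketL11` (owner GO-FILE terms 2026-08-28T20:28:38Z kept
that file at v0's declarations; these two theorems were the v0.1 addendum, moved here; lead 2026-08-28T20:25:26Z: «the (U)
tiles `σcell × [185/128, 8/5]` lie in `W₁₁ \ U₁₁` and are owed in the T1 strip branch as well»).)

HONEST FRAMING: lottery ticket; floor = tightest certified 3D Ising CFT bounds; floating SDPB islands are not certificates;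
nothing here is a bootstrap certificate; both theorems are CONDITIONAL on the certificate hypothesis structures they name.

`upperFaceCertificatesL11_of_strip : StripCertificatesL11 stair cover → UpperFaceCertificatesL11 (185/128) cover` — for every
admissible staircase (`⋃ stair ⊆ S₁₁plus`, cut `519/1000 >` every abscissa of `σcell`) the column segment `σcell × (185/128, 8/5]`
lies in `W₁₁ \ (B₁₁ ∪ ⋃ stair)`, hence in the union of the strip's tiles; that union is a finite union of closed boxes, so it
contains the closure `σcell × [185/128, 8/5]`. Consequently `isingColumnBracket_L11_window_of_strip`: in the T1 branch the
completed bracket TARGET follows from the strip certificates + the 42 column certificates of record + the lower sliver. [folklore]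
-/

namespace Summit.CriticalPhenomena.Ising3D

open Set Literature.MathematicalPhysics.QuantumFieldTheory.ConformalBootstrap3D

/-- A rational box is closed. [folklore] -/
theorem BoxQ.isClosed_toSet (Q : BoxQ) : IsClosed Q.toSet :=
  isClosed_Icc.prod isClosed_Icc

/-- A finite union of rational boxes is closed. [folklore] -/
theorem isClosed_biUnion_boxes (cover : List BoxQ) : IsClosed (⋃ Q ∈ cover, Q.toSet) :=
  (List.finite_toSet cover).isClosed_biUnion fun Q _ => BoxQ.isClosed_toSet Q

namespace ColumnBracketL11

open ColumnFaceL11 StripL11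

/-- On the σ-column, everything strictly above `B₁₁`'s top edge and inside the window lies in the strip region
`W₁₁ \ (B₁₁ ∪ S₁₁^□)` for every admissible staircase (`σcell`'s abscissae are `< 519/1000`, the envelope's cut). [folklore] -/
theorem colSegment_subset_diff {stair : List BoxQ} (hsub : (⋃ Q ∈ stair, Q.toSet) ⊆ S₁₁plus) :
    σcell ×ˢ Ioc (185 / 128 : ℝ) (8 / 5) ⊆ W₁₁ \ (B₁₁ ∪ ⋃ Q ∈ stair, Q.toSet) := by
  rintro ⟨σ, ε⟩ ⟨⟨h1, h2⟩, h3, h4⟩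
  norm_num at h1 h2
  refine ⟨⟨⟨by linarith, by linarith⟩, by linarith, h4⟩, ?_⟩
  rintro (⟨-, -, hB⟩ | hst)
  · linarith
  · have h5 := (hsub hst).2.1
    norm_num at h5
    linarith

/-- **The strip branch discharges the bracket's upper face**: under `StripCertificatesL11 stair cover` (T1 branch (1a)), the
same tiles give `UpperFaceCertificatesL11 (185/128) cover`. [folklore] -/
theorem upperFaceCertificatesL11_of_strip {stair cover : List BoxQ} (h : StripCertificatesL11 stair cover) :
    UpperFaceCertificatesL11 (185 / 128) cover := by
  refine ⟨fun p hp => ?_, h.excluded⟩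
  have hS : σcell ×ˢ Ioc (185 / 128 : ℝ) (8 / 5) ⊆ ⋃ Q ∈ cover, Q.toSet :=
    (colSegment_subset_diff h.stair_sub).trans h.covers
  have hcl : closure (σcell ×ˢ Ioc (185 / 128 : ℝ) (8 / 5)) ⊆ ⋃ Q ∈ cover, Q.toSet :=
    (isClosed_biUnion_boxes cover).closure_subset_iff.mpr hS
  refine hcl ?_
  rw [closure_prod_eq, closure_Ioc (by norm_num), show closure σcell = σcell from isClosed_Icc.closure_eq]
  have e : ((185 / 128 : ℚ) : ℝ) = 185 / 128 := by norm_num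
  rw [e] at hp
  exact hp

/-- Hence in the T1 branch the completed bracket TARGET follows from the strip certificates, the 42 column certificates of
record and the lower sliver alone (same CONDITIONAL status as its hypotheses). [folklore] -/
theorem isingColumnBracket_L11_window_of_strip (hcol : ColumnCertificatesL11) {stair cover coverL : List BoxQ}
    (h : StripCertificatesL11 stair cover) (hL : LowerSliverCertificatesL11 coverL) :
    IsingEnclosure (σcell ×ˢ Icc (6 / 5 : ℝ) (8 / 5)) (σcell ×ˢ Icc (2855 / 2048 : ℝ) (185 / 128)) :=
  isingColumnBracket_L11_window hcol (upperFaceCertificatesL11_of_strip h) hL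

/-- With the staircase OF RECORD: `StripCertificatesL11 stairFAT_v1 cover → UpperFaceCertificatesL11 (185/128) cover` is the
instance the T1 tiling leaf will use (stated for any `stair`; `stairFAT_v1` needs no special treatment). [folklore] -/
theorem upperFaceCertificatesL11_of_strip_mono {stair cover : List BoxQ} (h : StripCertificatesL11 stair cover) {e : ℚ}
    (he : (185 / 128 : ℚ) ≤ e) : UpperFaceCertificatesL11 e cover := by
  refine ⟨fun p hp => (upperFaceCertificatesL11_of_strip h).covers ⟨hp.1, ?_, hp.2.2⟩, h.excluded⟩
  have he' : ((185 / 128 : ℚ) : ℝ) ≤ (e : ℝ) := by exact_mod_cast he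
  exact he'.trans hp.2.1

/-! ### Addendum (referee-1 g4, O-g4-1, 2026-08-28T22:57:44Z): in the strip branch the LOWER sliver is paid by the strip
tiles too, so the TARGET needs no separate (L) leg — and the strip ALONE already brackets the column into `B₁₁`'s ε-range -/

/-- On the σ-column, everything at or below `81/64 < 89/64 = εlo(B₁₁)` inside the window lies in `W₁₁ \ (B₁₁ ∪ S₁₁^□)` for every
admissible staircase (no closure step needed: the sliver is strictly below `B₁₁`). [folklore] -/
theorem colLower_subset_diff {stair : List BoxQ} (hsub : (⋃ Q ∈ stair, Q.toSet) ⊆ S₁₁plus) :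
    σcell ×ˢ Icc (6 / 5 : ℝ) (81 / 64) ⊆ W₁₁ \ (B₁₁ ∪ ⋃ Q ∈ stair, Q.toSet) := by
  rintro ⟨σ, ε⟩ ⟨⟨h1, h2⟩, h3, h4⟩
  norm_num at h1 h2
  refine ⟨⟨⟨by linarith, by linarith⟩, h3, by linarith⟩, ?_⟩
  rintro (⟨-, hB, -⟩ | hst)
  · linarith
  · have h5 := (hsub hst).2.1
    norm_num at h5
    linarith

/-- **The strip branch discharges the bracket's lower sliver as well**: under `StripCertificatesL11 stair cover` the same tiles
give `LowerSliverCertificatesL11 cover`. [folklore] -/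
theorem lowerSliverCertificatesL11_of_strip {stair cover : List BoxQ} (h : StripCertificatesL11 stair cover) :
    LowerSliverCertificatesL11 cover :=
  ⟨(colLower_subset_diff h.stair_sub).trans h.covers, h.excluded⟩

/-- **TARGET from the strip certificates + the 42 column certificates of record ALONE** (referee-1 g4 O-g4-1: the `hL` hypothesis
of `isingColumnBracket_L11_window_of_strip` is superfluous — the T1 strip branch books no separate (L) leg for the bracket):
`ColumnCertificatesL11 → StripCertificatesL11 stair cover → IsingEnclosure (σcell ×ˢ Icc (6/5) (8/5)) (σcell ×ˢ Icc (2855/2048) (185/128))`.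
CONDITIONAL on both hypothesis structures; nothing about the CFT. [folklore] -/
theorem isingColumnBracket_L11_window_of_strip' (hcol : ColumnCertificatesL11) {stair cover : List BoxQ}
    (h : StripCertificatesL11 stair cover) :
    IsingEnclosure (σcell ×ˢ Icc (6 / 5 : ℝ) (8 / 5)) (σcell ×ˢ Icc (2855 / 2048 : ℝ) (185 / 128)) :=
  isingColumnBracket_L11_window_of_strip hcol h (lowerSliverCertificatesL11_of_strip h)

/-- **The strip ALONE brackets the σ-column into `B₁₁`'s ε-range** (no column certificate, no closure): under
`StripCertificatesL11 stair cover`, `Δσ ∈ σcell ∧ Δε ∈ [6/5, 8/5] ⇒ 89/64 ≤ Δε ≤ 185/128` — the column lies left of every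
admissible staircase (`σcell`'s abscissae `< 519/1000`), so on it the un-excluded set of the strip theorem is `B₁₁` itself.
Weaker below than the TARGET (`89/64 < 2855/2048`), which inherits the column campaign's lower face. [folklore] -/
theorem column_of_strip {stair cover : List BoxQ} (h : StripCertificatesL11 stair cover) :
    IsingEnclosure (σcell ×ˢ Icc (6 / 5 : ℝ) (8 / 5)) (σcell ×ˢ Icc (89 / 64 : ℝ) (185 / 128)) := by
  intro D hD hW
  obtain ⟨hσ, h3, h4⟩ := hW
  obtain ⟨h1, h2⟩ := id hσ
  norm_num at h1 h2
  have hWin : (D.Δσ, D.Δε) ∈ W₁₁ := ⟨⟨by linarith, by linarith⟩, h3, h4⟩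
  rcases isingStrip_L11 h D hD hWin with hB | hst
  · exact ⟨hσ, hB.2.1, hB.2.2⟩
  · have h5 := (h.stair_sub hst).2.1
    norm_num at h5
    linarith

end ColumnBracketL11

end Summit.CriticalPhenomena.Ising3D
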